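import Summits.SmoothPoincare4.SmoothPoincare4.Theses.CongruenceShadows
import Summits.SmoothPoincare4.SmoothPoincare4.Theorems.HeegaardHandlebodyCongruenceClosed.Negative.Gate
import Summits.SmoothPoincare4.SmoothPoincare4.Theorems.WaldhausenPairs.Negative.PairTransferFalse

/-!
# `CongruenceApproximable` (item stmt-SmoothPoincare4-14855, route CongruenceShadows) — logical position

Sorry-free structure lemmas for the crux-grade support item
`Summit.SmoothPoincare4.SmoothPoincare4.Theses.CongruenceShadows.CongruenceApproximable`
(closure form of the approximation crux `ShadowApproximation`, stmt-SmoothPoincare4-14595).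
Notation (from `Theorems/HeegaardHandlebodyCongruenceClosed/Negative/Gate.lean`): `S m = S_{3+3m}`,
`N m = s4Kernels.stabilizeIter m`, `gate m = (A∩B)·C ⊆ Aut S` (`A∩B = Stab N₀ ∩ Stab N₁`, `C = Stab N₂`),
`gateMod m M = (A∩B)·C·K_M` (product-congruence modulo the level `M`).

* §1 `gateMod_doubleCoset` — for `M` characteristic, `gateMod m M` is a union of `(A∩B, C)` double cosets.
* §2 `transfer` — any two remarking/twist pairs `(α, ρ)`, `(α', ρ')` of the same `K` differ by such a double
  coset: `ρ' = x₀ ∘ ρ ∘ c₀`, `x₀ ∈ A∩B`, `c₀ ∈ C`.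
* §3 `iff_forall` — hence the item's `∃ α ρ` may be replaced by `∀ α ρ`: the level-wise factorisation
  property does not depend on the choice of the remarking (refuters need test only ONE pair `(α, ρ)`).
* §4 `iff_gateForm` — the item in gate form: for `β ∈ A` and `γ ∈ B` with `βN₂ = γN₂` such that
  `T_β = (N₀, N₁, βN₂)` is a `(3+3m; m+1)` group trisection of `{1}` with standard characteristic finite
  shadows, `β ∈ gateMod m M` for every characteristic finite-index `M` — i.e.
  `A ∩ B·C ∩ {trisection of {1}} ∩ {standard shadows} ⊆ ⋂_M (A∩B)·C·K_M`, the congruence CLOSURE of the gate;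
  `shadowApproximation_iff_gateForm` — the crux is the same inclusion into the gate itself;
  `levelFactorisation_of_shadows` — what the shadow hypothesis gives for free on that locus: an EXACT
  factorisation `β = a ∘ c` into LEVEL stabilisers (`a(NᵢM) = NᵢM`, `i = 0,1`, `c(N₂M) = N₂M`), whereas the
  item wants congruence mod `M` to a product of EXACT stabilisers (level stabilisers do not lift:
  `Theorems/ShadowApproximation/Negative/LevelSymmetriesFalse.lean`).
* §5 `of_shadowApproximation` (`ShadowApproximation →` item) and
  `shadowApproximation_iff_and_closedOnLocus` (`ShadowApproximation ↔` item `∧` closedness of the gate ON THE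
  LOCUS), sharpening the first conjunct of `ArtinGates` (which uses the unrestricted closedness
  `HeegaardHandlebodyCongruenceClosed`, stmt-SmoothPoincare4-14596).

No named facts; imports two landed negative-side support files for the gate vocabulary and the transport
lemma `IsGroupTrisection.map_mulEquiv`.
-/

-- the prescribed namespace `Summit.<P>.<Sub>.…` duplicates `SmoothPoincare4` (P = Sub)
set_option linter.dupNamespace false

noncomputable section

namespace Summit.SmoothPoincare4.SmoothPoincare4.Theorems.CongruenceApproximable

open Literature.Topology.FourManifolds Subgroup
open Summit.SmoothPoincare4.SmoothPoincare4.Theses.CongruenceShadows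
open Summit.SmoothPoincare4.SmoothPoincare4.Theorems.HeegaardHandlebodyCongruenceClosed.Negative
  (S N gate gateMod map_trans inGate_iff)
open Summit.SmoothPoincare4.SmoothPoincare4.Theorems.WaldhausenPairs.Negative (IsGroupTrisection.map_mulEquiv)

/-! ## §0 Conventions

Throughout, "`K` is normalised" is the hypothesis `∀ i j, i ≠ j → ∃ α, αNᵢ = Kᵢ ∧ αNⱼ = Kⱼ` of the item,
"`K` has standard shadows" is `∀ M char. f.i., ∃ ψ, ∀ i, ψ(Nᵢ ⊔ M) = Kᵢ ⊔ M`, and the twisted triple of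
`β ∈ Aut S` is `T_β = ![N m 0, N m 1, (N m 2).map β]`; all three are written out in full (no local
definitions, so that the file stays a pure proof file). The item itself is, verbatim,
"`∀ m K`, trisection of `{1}` → normalised → standard shadows → `∃ α ρ`, `αN₀ = K₀ ∧ αN₁ = K₁ ∧ αρN₂ = K₂ ∧`
`∀ M char. f.i., ρ ∈ gateMod m M`" (`gateMod` unfolds to the printed `∃ x c, …`).
-/

/-! ## Elementary `map` algebra for automorphisms -/

/-- `map` along the identity automorphism. [folklore] -/
theorem map_refl {m : ℕ} (H : Subgroup (S m)) : H.map (MulEquiv.refl (S m)).toMonoidHom = H := by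
  ext s
  simp

/-- `eN = L ⇒ e⁻¹L = N`. [folklore] -/
theorem map_symm_of_map_eq {m : ℕ} {e : S m ≃* S m} {H L : Subgroup (S m)}
    (h : H.map e.toMonoidHom = L) : L.map e.symm.toMonoidHom = H := by
  rw [← h, ← map_trans, MulEquiv.self_trans_symm, map_refl]

/-- A characteristic subgroup is carried to itself by every automorphism. [folklore] -/
theorem map_char {m : ℕ} (x : S m ≃* S m) {M : Subgroup (S m)} (hM : M.Characteristic) :
    M.map x.toMonoidHom = M :=
  (Subgroup.characteristic_iff_map_eq.mp hM) x

/-! ## §1 `gateMod m M` is a union of `(A∩B, C)` double cosets -/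

/-- **Double cosets.** If `ρ ≡ x ∘ c (mod M)` with `x ∈ A∩B`, `c ∈ C`, and `x₀ ∈ A∩B`, `c₀ ∈ C`, then
`x₀ ∘ ρ ∘ c₀ ≡ (x₀ ∘ x) ∘ (c ∘ c₀) (mod M)` (`M` characteristic, so `x₀(M) = M`). [folklore] -/
theorem gateMod_doubleCoset {m : ℕ} {M : Subgroup (S m)} (hM : M.Characteristic) {ρ x₀ c₀ : S m ≃* S m}
    (hρ : ρ ∈ gateMod m M) (hx0 : (N m 0).map x₀.toMonoidHom = N m 0)
    (hx1 : (N m 1).map x₀.toMonoidHom = N m 1) (hc0 : (N m 2).map c₀.toMonoidHom = N m 2) :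
    c₀.trans (ρ.trans x₀) ∈ gateMod m M := by
  obtain ⟨x, c, h0, h1, h2, h⟩ := hρ
  refine ⟨x.trans x₀, c₀.trans c, ?_, ?_, ?_, fun s => ?_⟩
  · rw [map_trans, h0, hx0]
  · rw [map_trans, h1, hx1]
  · rw [map_trans, hc0, h2]
  · have hmem : x₀ (ρ (c₀ s) * (x (c (c₀ s)))⁻¹) ∈ M.map x₀.toMonoidHom := ⟨_, h (c₀ s), rfl⟩
    rw [map_char x₀ hM] at hmem
    simpa using hmem

/-! ## §2 Two remarking/twist pairs of the same `K` differ by a double coset -/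

/-- **Transfer.** If `(α, ρ)` and `(α', ρ')` both remark `K` (`αN₀ = K₀ = α'N₀`, `αN₁ = K₁ = α'N₁`,
`αρN₂ = K₂ = α'ρ'N₂`), then `ρ' = x₀ ∘ ρ ∘ c₀` with `x₀ := α'⁻¹ ∘ α ∈ A∩B` and
`c₀ := ρ⁻¹ ∘ x₀⁻¹ ∘ ρ' ∈ C`. [folklore] -/
theorem transfer {m : ℕ} {K : TrisectionKernels (3 + 3 * m)} {α ρ α' ρ' : S m ≃* S m}
    (h0 : (N m 0).map α.toMonoidHom = K 0) (h1 : (N m 1).map α.toMonoidHom = K 1)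
    (h2 : ((N m 2).map ρ.toMonoidHom).map α.toMonoidHom = K 2)
    (h0' : (N m 0).map α'.toMonoidHom = K 0) (h1' : (N m 1).map α'.toMonoidHom = K 1)
    (h2' : ((N m 2).map ρ'.toMonoidHom).map α'.toMonoidHom = K 2) :
    ∃ x₀ c₀ : S m ≃* S m, (N m 0).map x₀.toMonoidHom = N m 0 ∧ (N m 1).map x₀.toMonoidHom = N m 1 ∧
      (N m 2).map c₀.toMonoidHom = N m 2 ∧ ρ' = c₀.trans (ρ.trans x₀) := by
  refine ⟨α.trans α'.symm, ρ'.trans (α'.trans (α.symm.trans ρ.symm)), ?_, ?_, ?_, ?_⟩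
  · rw [map_trans, h0, map_symm_of_map_eq h0']
  · rw [map_trans, h1, map_symm_of_map_eq h1']
  · -- `ρ⁻¹ α⁻¹ α' ρ' N₂ = ρ⁻¹ α⁻¹ K₂ = ρ⁻¹ ρ N₂ = N₂`
    rw [map_trans, map_trans, map_trans, h2', map_symm_of_map_eq h2, map_symm_of_map_eq rfl]
  · ext s
    simp

/-! ## §3 The `∃ α ρ` of the item may be read `∀ α ρ` -/

/-- Some remarking pair exists as soon as the pairs `(0,1)` and `(0,2)` are standard: `α` from the pair
`(0,1)`, `ρ := α⁻¹ ∘ β` with `β` from the pair `(0,2)`. [folklore] -/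
theorem exists_remarking {m : ℕ} {K : TrisectionKernels (3 + 3 * m)}
    (hP : (∀ i j : Fin 3, i ≠ j → ∃ α : S m ≃* S m, (N m i).map α.toMonoidHom = K i ∧ (N m j).map α.toMonoidHom = K j)) :
    ∃ α ρ : S m ≃* S m, (N m 0).map α.toMonoidHom = K 0 ∧ (N m 1).map α.toMonoidHom = K 1 ∧
      ((N m 2).map ρ.toMonoidHom).map α.toMonoidHom = K 2 := by
  obtain ⟨α, hα0, hα1⟩ := hP 0 1 (by decide)
  obtain ⟨β, -, hβ2⟩ := hP 0 2 (by decide)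
  refine ⟨α, β.trans α.symm, hα0, hα1, ?_⟩
  have e : (β.trans α.symm).trans α = β := by
    ext s
    simp
  rw [← map_trans, e, hβ2]

/-- **Choice independence.** The item is equivalent to its `∀ α ρ` form: under its hypotheses EVERY
remarking pair `(α, ρ)` has `ρ` product-congruent at every characteristic finite-index level. [folklore] -/
theorem iff_forall :
    CongruenceApproximable ↔ ∀ (m : ℕ) (K : TrisectionKernels (3 + 3 * m)),
      IsGroupTrisection (3 + 3 * m) (m + 1) (PUnit : Type) K →
      (∀ i j : Fin 3, i ≠ j → ∃ α : S m ≃* S m, (N m i).map α.toMonoidHom = K i ∧ (N m j).map α.toMonoidHom = K j) →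
      (∀ M : Subgroup (S m), M.Characteristic → M.FiniteIndex →
        ∃ ψ : S m ≃* S m, ∀ i : Fin 3, (N m i ⊔ M).map ψ.toMonoidHom = K i ⊔ M) →
        ∀ α ρ : S m ≃* S m, (N m 0).map α.toMonoidHom = K 0 → (N m 1).map α.toMonoidHom = K 1 →
          ((N m 2).map ρ.toMonoidHom).map α.toMonoidHom = K 2 →
          ∀ M : Subgroup (S m), M.Characteristic → M.FiniteIndex → ρ ∈ gateMod m M := by
  constructor
  · intro h m K hK hP hS α' ρ' h0' h1' h2' M hM hF
    obtain ⟨α, ρ, h0, h1, h2, hρ⟩ := h m K hK hP hS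
    obtain ⟨x₀, c₀, hx0, hx1, hc0, rfl⟩ := transfer h0 h1 h2 h0' h1' h2'
    exact gateMod_doubleCoset hM (hρ M hM hF) hx0 hx1 hc0
  · intro h m K hK hP hS
    obtain ⟨α, ρ, h0, h1, h2⟩ := exists_remarking hP
    exact ⟨α, ρ, h0, h1, h2, h m K hK hP hS α ρ h0 h1 h2⟩

/-! ## §4 Normalisation and the gate form -/

/-- `Shadows` is transported along automorphisms (`M` characteristic). [folklore] -/
theorem shadows_map {m : ℕ} {K : TrisectionKernels (3 + 3 * m)}
    (hS : ∀ M : Subgroup (S m), M.Characteristic → M.FiniteIndex →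
      ∃ ψ : S m ≃* S m, ∀ i : Fin 3, (N m i ⊔ M).map ψ.toMonoidHom = K i ⊔ M) (e : S m ≃* S m) :
    ∀ M : Subgroup (S m), M.Characteristic → M.FiniteIndex →
      ∃ ψ : S m ≃* S m, ∀ i : Fin 3, (N m i ⊔ M).map ψ.toMonoidHom = (K i).map e.toMonoidHom ⊔ M := by
  intro M hM hF
  obtain ⟨ψ, hψ⟩ := hS M hM hF
  refine ⟨ψ.trans e, fun i => ?_⟩
  rw [map_trans, hψ i, Subgroup.map_sup, map_char e hM]

/-- The twisted triple `T_β` is Waldhausen-normalised as soon as `β ∈ A` and `βN₂ = γN₂` for some `γ ∈ B`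
(witnesses `id`, `β`, `γ` for the pairs `(0,1)`, `(0,2)`, `(1,2)`). [folklore] -/
theorem pairs_twisted {m : ℕ} {β γ : S m ≃* S m} (hβ0 : (N m 0).map β.toMonoidHom = N m 0)
    (hγ1 : (N m 1).map γ.toMonoidHom = N m 1) (hγ2 : (N m 2).map γ.toMonoidHom = (N m 2).map β.toMonoidHom) :
    ∀ i j : Fin 3, i ≠ j → ∃ α : S m ≃* S m,
      (N m i).map α.toMonoidHom = (![N m 0, N m 1, (N m 2).map β.toMonoidHom] : TrisectionKernels (3 + 3 * m)) i ∧
      (N m j).map α.toMonoidHom = (![N m 0, N m 1, (N m 2).map β.toMonoidHom] : TrisectionKernels (3 + 3 * m)) j := by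
  intro i j hij
  fin_cases i <;> fin_cases j
  · exact absurd rfl hij
  · exact ⟨MulEquiv.refl _, map_refl _, map_refl _⟩
  · exact ⟨β, hβ0, rfl⟩
  · exact ⟨MulEquiv.refl _, map_refl _, map_refl _⟩
  · exact absurd rfl hij
  · exact ⟨γ, hγ1, hγ2⟩
  · exact ⟨β, rfl, hβ0⟩
  · exact ⟨γ, hγ2, hγ1⟩
  · exact absurd rfl hij

/-- **Normalisation.** A Waldhausen-normalised `K` with standard shadows is `α • T_β` for a remarking `α` of
the standard pair and a twist `β ∈ A` with `βN₂ = γN₂`, `γ ∈ B`; the twisted triple `T_β = α⁻¹ • K` is again a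
group trisection of `{1}` (transport) with standard shadows (`M` characteristic). [folklore] -/
theorem normalise {m : ℕ} {K : TrisectionKernels (3 + 3 * m)}
    (hK : IsGroupTrisection (3 + 3 * m) (m + 1) (PUnit : Type) K)
    (hP : (∀ i j : Fin 3, i ≠ j → ∃ α : S m ≃* S m, (N m i).map α.toMonoidHom = K i ∧ (N m j).map α.toMonoidHom = K j))
    (hS : ∀ M : Subgroup (S m), M.Characteristic → M.FiniteIndex →
      ∃ ψ : S m ≃* S m, ∀ i : Fin 3, (N m i ⊔ M).map ψ.toMonoidHom = K i ⊔ M) :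
    ∃ α β γ : S m ≃* S m,
      (N m 0).map α.toMonoidHom = K 0 ∧ (N m 1).map α.toMonoidHom = K 1 ∧
      ((N m 2).map β.toMonoidHom).map α.toMonoidHom = K 2 ∧
      (N m 0).map β.toMonoidHom = N m 0 ∧ (N m 1).map γ.toMonoidHom = N m 1 ∧
      (N m 2).map γ.toMonoidHom = (N m 2).map β.toMonoidHom ∧
      IsGroupTrisection (3 + 3 * m) (m + 1) (PUnit : Type) (![N m 0, N m 1, (N m 2).map β.toMonoidHom] : TrisectionKernels (3 + 3 * m)) ∧
      (∀ M : Subgroup (S m), M.Characteristic → M.FiniteIndex → ∃ ψ : S m ≃* S m, ∀ i : Fin 3,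
        (N m i ⊔ M).map ψ.toMonoidHom = (![N m 0, N m 1, (N m 2).map β.toMonoidHom] : TrisectionKernels (3 + 3 * m)) i ⊔ M) := by
  obtain ⟨α, hα0, hα1⟩ := hP 0 1 (by decide)
  obtain ⟨β', hβ0, hβ2⟩ := hP 0 2 (by decide)
  obtain ⟨γ', hγ1, hγ2⟩ := hP 1 2 (by decide)
  have hK' : (![N m 0, N m 1, (N m 2).map (β'.trans α.symm).toMonoidHom] : TrisectionKernels (3 + 3 * m)) =
      fun i => (K i).map α.symm.toMonoidHom := by
    funext i
    fin_cases i
    · exact (map_symm_of_map_eq hα0).symm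
    · exact (map_symm_of_map_eq hα1).symm
    · show (N m 2).map (β'.trans α.symm).toMonoidHom = (K 2).map α.symm.toMonoidHom
      rw [map_trans, hβ2]
  refine ⟨α, β'.trans α.symm, γ'.trans α.symm, hα0, hα1, ?_, ?_, ?_, ?_, ?_, ?_⟩
  · have e : (β'.trans α.symm).trans α = β' := by
      ext s
      simp
    rw [← map_trans, e, hβ2]
  · rw [map_trans, hβ0, map_symm_of_map_eq hα0]
  · rw [map_trans, hγ1, map_symm_of_map_eq hα1]
  · rw [map_trans, hγ2, map_trans, hβ2]
  · rw [hK']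
    exact IsGroupTrisection.map_mulEquiv hK α.symm
  · rw [hK']
    exact shadows_map hS α.symm

/-- **Gate form of the item.** `CongruenceApproximable` says exactly: for `β ∈ A = Stab N₀` and
`γ ∈ B = Stab N₁` with `βN₂ = γN₂` such that `T_β = (N₀, N₁, βN₂)` is a `(3+3m; m+1)` group trisection of the
trivial group all of whose characteristic finite shadows are standard, `β` is product-congruent
(`β ∈ (A∩B)·C·K_M`) at every characteristic finite-index level `M` — the inclusion
`A ∩ B·C ∩ T ∩ Sh ⊆ cl((A∩B)·C)` into the congruence closure of the gate. [folklore] -/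
theorem iff_gateForm :
    CongruenceApproximable ↔ ∀ (m : ℕ) (β γ : S m ≃* S m), (N m 0).map β.toMonoidHom = N m 0 →
      (N m 1).map γ.toMonoidHom = N m 1 → (N m 2).map γ.toMonoidHom = (N m 2).map β.toMonoidHom →
      IsGroupTrisection (3 + 3 * m) (m + 1) (PUnit : Type) (![N m 0, N m 1, (N m 2).map β.toMonoidHom] : TrisectionKernels (3 + 3 * m)) →
      (∀ M : Subgroup (S m), M.Characteristic → M.FiniteIndex → ∃ ψ : S m ≃* S m, ∀ i : Fin 3,
        (N m i ⊔ M).map ψ.toMonoidHom = (![N m 0, N m 1, (N m 2).map β.toMonoidHom] : TrisectionKernels (3 + 3 * m)) i ⊔ M) →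
        ∀ M : Subgroup (S m), M.Characteristic → M.FiniteIndex → β ∈ gateMod m M := by
  rw [iff_forall]
  constructor
  · intro h m β γ hβ0 hγ1 hγ2 hT hSh
    exact h m (![N m 0, N m 1, (N m 2).map β.toMonoidHom] : TrisectionKernels (3 + 3 * m)) hT (pairs_twisted hβ0 hγ1 hγ2) hSh (MulEquiv.refl _) β (map_refl _) (map_refl _)
      (map_refl _)
  · intro h m K hK hP hS α' ρ' h0' h1' h2' M hM hF
    obtain ⟨α, β, γ, h0, h1, h2, hβ0, hγ1, hγ2, hT, hSh⟩ := normalise hK hP hS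
    obtain ⟨x₀, c₀, hx0, hx1, hc0, rfl⟩ := transfer h0 h1 h2 h0' h1' h2'
    exact gateMod_doubleCoset hM (h m β γ hβ0 hγ1 hγ2 hT hSh M hM hF) hx0 hx1 hc0

/-- **Gate form of the crux** `ShadowApproximation` (stmt-SmoothPoincare4-14595): the same locus lies in the
gate itself, `A ∩ B·C ∩ T ∩ Sh ⊆ (A∩B)·C`. [folklore] -/
theorem shadowApproximation_iff_gateForm :
    ShadowApproximation ↔ ∀ (m : ℕ) (β γ : S m ≃* S m), (N m 0).map β.toMonoidHom = N m 0 →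
      (N m 1).map γ.toMonoidHom = N m 1 → (N m 2).map γ.toMonoidHom = (N m 2).map β.toMonoidHom →
      IsGroupTrisection (3 + 3 * m) (m + 1) (PUnit : Type) (![N m 0, N m 1, (N m 2).map β.toMonoidHom] : TrisectionKernels (3 + 3 * m)) →
      (∀ M : Subgroup (S m), M.Characteristic → M.FiniteIndex → ∃ ψ : S m ≃* S m, ∀ i : Fin 3,
        (N m i ⊔ M).map ψ.toMonoidHom = (![N m 0, N m 1, (N m 2).map β.toMonoidHom] : TrisectionKernels (3 + 3 * m)) i ⊔ M) →
        β ∈ gate m := by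
  constructor
  · intro h m β γ hβ0 hγ1 hγ2 hT hSh
    obtain ⟨x, hx⟩ := h m (![N m 0, N m 1, (N m 2).map β.toMonoidHom] : TrisectionKernels (3 + 3 * m)) hT (pairs_twisted hβ0 hγ1 hγ2) hSh
    exact (inGate_iff m β).2 ⟨x, hx 0, hx 1, hx 2⟩
  · intro h m K hK hP hS
    obtain ⟨α, β, γ, h0, h1, h2, hβ0, hγ1, hγ2, hT, hSh⟩ := normalise hK hP hS
    obtain ⟨x, hx0, hx1, hx2⟩ := (inGate_iff m β).1 (h m β γ hβ0 hγ1 hγ2 hT hSh)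
    refine ⟨x.trans α, fun i => ?_⟩
    fin_cases i
    · show (N m 0).map (x.trans α).toMonoidHom = K 0
      rw [map_trans, hx0, h0]
    · show (N m 1).map (x.trans α).toMonoidHom = K 1
      rw [map_trans, hx1, h1]
    · show (N m 2).map (x.trans α).toMonoidHom = K 2
      rw [map_trans, hx2, h2]

/-- WHAT THE SHADOWS GIVE FOR FREE (the gap the item must close): on the locus, `β` factors EXACTLY as
`a ∘ c` with `a`, `c` LEVEL stabilisers (`a(NᵢM) = NᵢM`, `i = 0,1`; `c(N₂M) = N₂M`), namely `a := ψ_M`,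
`c := ψ_M⁻¹ ∘ β`; the item asks instead for congruence mod `M` to a product of EXACT stabilisers, and level
stabilisers need not be congruent to exact ones (`Negative/LevelSymmetriesFalse.lean`: unit twists). [folklore] -/
theorem levelFactorisation_of_shadows {m : ℕ} {β : S m ≃* S m}
    (hSh : ∀ M : Subgroup (S m), M.Characteristic → M.FiniteIndex → ∃ ψ : S m ≃* S m, ∀ i : Fin 3,
        (N m i ⊔ M).map ψ.toMonoidHom = (![N m 0, N m 1, (N m 2).map β.toMonoidHom] : TrisectionKernels (3 + 3 * m)) i ⊔ M)
    (M : Subgroup (S m)) (hM : M.Characteristic) (hF : M.FiniteIndex) :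
    ∃ a c : S m ≃* S m, (N m 0 ⊔ M).map a.toMonoidHom = N m 0 ⊔ M ∧ (N m 1 ⊔ M).map a.toMonoidHom = N m 1 ⊔ M ∧
      (N m 2 ⊔ M).map c.toMonoidHom = N m 2 ⊔ M ∧ ∀ s, β s = a (c s) := by
  obtain ⟨ψ, hψ⟩ := hSh M hM hF
  refine ⟨ψ, β.trans ψ.symm, hψ 0, hψ 1, ?_, fun s => by simp⟩
  have h2 : (N m 2 ⊔ M).map ψ.toMonoidHom = (N m 2).map β.toMonoidHom ⊔ M := hψ 2
  rw [map_trans, Subgroup.map_sup, map_char β hM, ← h2, ← map_trans, MulEquiv.self_trans_symm, map_refl]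

/-! ## §5 Logical position -/

/-- **`ShadowApproximation →` item** (`ρ := id`, and `x = c := id` at every level). [folklore] -/
theorem of_shadowApproximation (hA : ShadowApproximation) : CongruenceApproximable := by
  intro m K hK hW hS
  obtain ⟨α, hα⟩ := hA m K hK hW hS
  refine ⟨α, MulEquiv.refl _, hα 0, hα 1, ?_, fun M _ _ => ?_⟩
  · rw [map_refl]
    exact hα 2
  · exact ⟨MulEquiv.refl _, MulEquiv.refl _, map_refl _, map_refl _, map_refl _, fun s => by simp [M.one_mem]⟩

/-- **`ShadowApproximation ↔` item `∧` closedness of the gate ON THE LOCUS.** The crux splits EXACTLY into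
the item (locus `⊆` closure of the gate) and the closedness of the gate restricted to the locus (sharper than
the first conjunct of `ArtinGates`, which uses the unrestricted closedness `HeegaardHandlebodyCongruenceClosed`).
[folklore] -/
theorem shadowApproximation_iff_and_closedOnLocus :
    ShadowApproximation ↔ CongruenceApproximable ∧ ∀ (m : ℕ) (β γ : S m ≃* S m), (N m 0).map β.toMonoidHom = N m 0 →
      (N m 1).map γ.toMonoidHom = N m 1 → (N m 2).map γ.toMonoidHom = (N m 2).map β.toMonoidHom →
      IsGroupTrisection (3 + 3 * m) (m + 1) (PUnit : Type) (![N m 0, N m 1, (N m 2).map β.toMonoidHom] : TrisectionKernels (3 + 3 * m)) →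
      (∀ M : Subgroup (S m), M.Characteristic → M.FiniteIndex → ∃ ψ : S m ≃* S m, ∀ i : Fin 3,
        (N m i ⊔ M).map ψ.toMonoidHom = (![N m 0, N m 1, (N m 2).map β.toMonoidHom] : TrisectionKernels (3 + 3 * m)) i ⊔ M) →
        (∀ M : Subgroup (S m), M.Characteristic → M.FiniteIndex → β ∈ gateMod m M) → β ∈ gate m := by
  constructor
  · intro h
    exact ⟨of_shadowApproximation h, fun m β γ hβ0 hγ1 hγ2 hT hSh _ =>
      shadowApproximation_iff_gateForm.1 h m β γ hβ0 hγ1 hγ2 hT hSh⟩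
  · rintro ⟨hCA, hcl⟩
    exact shadowApproximation_iff_gateForm.2 fun m β γ hβ0 hγ1 hγ2 hT hSh =>
      hcl m β γ hβ0 hγ1 hγ2 hT hSh (iff_gateForm.1 hCA m β γ hβ0 hγ1 hγ2 hT hSh)

/-- `HeegaardHandlebodyCongruenceClosed` (stmt-SmoothPoincare4-14596) is closedness of the gate everywhere, in
particular on the locus; hence the first conjunct of `ArtinGates`: item `→ HHCC → ShadowApproximation`.
[folklore] -/
theorem shadowApproximation_of_ca_of_hhcc (hCA : CongruenceApproximable) (hC : HeegaardHandlebodyCongruenceClosed) :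
    ShadowApproximation :=
  shadowApproximation_iff_and_closedOnLocus.2 ⟨hCA, fun m β _ _ _ _ _ _ hβ => hC m β hβ⟩

end Summit.SmoothPoincare4.SmoothPoincare4.Theorems.CongruenceApproximable

end
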